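import Literature.NumberTheory.EllipticCurves.KohelShparlinskiCoordinateCharacters
import Literature.NumberTheory.GaussSums.FiniteFieldTraceCharacter
import Literature.NumberTheory.DiophantineGeometry.FunctionFieldRayClassLSeriesEuler
import Mathlib.Analysis.Fourier.FiniteAbelian.PontryaginDuality
import HarnessLib

/-!
# Kohel–Shparlinski orbit sums, character side: `Σ_{ω', c} χ_{ω',c}(v)^m` at a place `v`

Topic `NumberTheory/EllipticCurves`. For an elliptic curve `W` over a finite field `F` of characteristic
`p`, a nontrivial additive character `ψ` with kernel the trace hyperplane `{a : Tr_{F/𝔽_p}(β a) = 0}`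
(`FiniteFieldTraceCharacter.exists_apply_eq_one_iff_trace_mul`) and the Kohel–Shparlinski characters
`χ_{ω',c} = ω' · (ψ ∘ x)^c = coordChar ω' (ψ^c) x` (`KohelShparlinskiCoordinateCharacters`), this file
evaluates the sum over the whole family `(ω', c) ∈ Hom(W(F), ℂ*) × {0, …, p-1}` of the `m`-th powers of
the values at a place `v ≠ ∞` of `F(W)`:

* `coordChar_pow_single` — `χ_{ω',c}(v) = ω'(pt v) · ψ(t_v)^c`, `t_v = Tr_{F_v/F}(x mod v)`
  (`pt = pointOfDivisor`);
* `sum_sum_coordChar_single_pow` — **orthogonality**: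
  `Σ_{ω'} Σ_{c<p} χ_{ω',c}(v)^m = n · [m · pt(v) = O] · p · [ψ(m t_v) = 1]`, `n = #W(F)`
  (Mathlib `AddChar.sum_apply_eq_ite` over `Hom(W(F), ℂ*)` and `sum_range_pow_apply` over the powers of
  `ψ`);
* `apply_nsmul_traceResidue_eq_one_iff` — `ψ(m t_v) = 1 ↔ m · Tr_{F_v/𝔽_p}((β x) mod v) = 0` (transitivity
  of the trace `𝔽_p ⊆ F ⊆ F_v`), the condition governing the splitting of the places above `v` in the
  Artin–Schreier layer `z^p - z = λ(β x)`;
* `orbitCount_arith` — the elementary identity matching this with the place count of the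
  Lang–Artin–Schreier covering above `v` (`FunctionFieldArtinSchreierTowerCount`): for `d ∣ r`, `m = r/d`,
  `d · (n[f ∣ m]) · (p[m c = 0]) = n p d · ([f d ∣ r] if f c = 0 else [p f d ∣ r])` in terms of the residue
  degree `f` of `v` in the Lang covering and `c = Tr_{F_v/𝔽_p}((β x) mod v) ∈ 𝔽_p`.

Everything is proved; no definitions; no named facts.

## References

* D. R. Kohel, I. E. Shparlinski, *On exponential sums and group generators for elliptic curves over
  finite fields*, ANTS-IV, LNCS 1838 (2000), §2 (the covering and its characters), proof of Cor. 1
  (orthogonality). [KohelShparlinski2000]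
-/

noncomputable section

open scoped Classical

namespace Literature.NumberTheory.EllipticCurves.KohelShparlinski

open Literature.NumberTheory.DiophantineGeometry
open AlgFunctionField WeierstrassPlaceAtInfinity WeierstrassFunctionField WeierstrassRationalPlaces
  WeierstrassDivisorClassPoints Literature.NumberTheory.GaussSums.FiniteFieldTraceCharacter

universe u

variable {F : Type u} [Field F] (V : WeierstrassCurve.Affine F) [V.IsElliptic]

/-! ### The values `χ_{ω',c}(v)` -/

/-- **`χ_{ω',c}(v) = ω'(pt v) · ψ(t_v)^c`** with `t_v = traceResidue ∞ x v = Tr_{F_v/F}(x mod v)`.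
[cite: KohelShparlinski2000, §2] -/
theorem coordChar_pow_single (ω : AddChar V.Point ℂ) (ψ : AddChar F ℂ) (c : ℕ) (f : V.FunctionField)
    (v : PlaceOver F V.FunctionField) :
    coordChar V ω (ψ ^ c) f (Finsupp.single v 1) =
      ω (pointOfDivisor V (Finsupp.single v 1)) * ψ (PlaceOver.traceResidue (infPlace V) f v) ^ c := by
  rw [coordChar, AddChar.mul_apply, divisorChar_apply, PlaceOver.traceResidueChar_single, Int.cast_one,
    one_mul, AddChar.pow_apply]

/-- `χ_{ω',c}(v)^m = ω'(m · pt v) · ψ(m · t_v)^c`. [cite: KohelShparlinski2000, §2] -/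
theorem coordChar_pow_single_pow (ω : AddChar V.Point ℂ) (ψ : AddChar F ℂ) (c : ℕ) (f : V.FunctionField)
    (v : PlaceOver F V.FunctionField) (m : ℕ) :
    coordChar V ω (ψ ^ c) f (Finsupp.single v 1) ^ m =
      ω (m • pointOfDivisor V (Finsupp.single v 1)) *
        ψ (m • PlaceOver.traceResidue (infPlace V) f v) ^ c := by
  rw [coordChar_pow_single, mul_pow, AddChar.map_nsmul_eq_pow, AddChar.map_nsmul_eq_pow, ← pow_mul,
    ← pow_mul, mul_comm c m]

/-! ### Orthogonality over the family -/

/-- **Orthogonality over the Kohel–Shparlinski family**: for a place `v` and `m ∈ ℕ`,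
`Σ_{ω' ∈ Hom(W(F),ℂ*)} Σ_{c<p} χ_{ω',c}(v)^m = (n · [m · pt(v) = O]) · (p · [ψ(m t_v) = 1])` with
`n = #W(F)` (character orthogonality on `W(F)` and on `⟨ψ⟩ ≅ 𝔽_p`).
[cite: KohelShparlinski2000, proof of Cor. 1 (orthogonality of characters)] -/
theorem sum_sum_coordChar_single_pow [Finite V.Point] (p : ℕ) [CharP F p] (ψ : AddChar F ℂ)
    (f : V.FunctionField) (v : PlaceOver F V.FunctionField) (m : ℕ) :
    ∑ ω : AddChar V.Point ℂ, ∑ c ∈ Finset.range p, coordChar V ω (ψ ^ c) f (Finsupp.single v 1) ^ m =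
      (if m • pointOfDivisor V (Finsupp.single v 1) = 0 then (Nat.card V.Point : ℂ) else 0) *
        (if ψ (m • PlaceOver.traceResidue (infPlace V) f v) = 1 then (p : ℂ) else 0) := by
  letI : Fintype V.Point := Fintype.ofFinite _
  simp_rw [coordChar_pow_single_pow]
  rw [← Finset.sum_mul_sum, AddChar.sum_apply_eq_ite, sum_range_pow_apply, Nat.card_eq_fintype_card]

/-! ### The splitting condition `ψ(m t_v) = 1` as a trace condition in `F_v` -/

omit [V.IsElliptic] in
/-- **`ψ(m · Tr_{F_v/F}(x mod v)) = 1 ↔ m · Tr_{F_v/𝔽_p}((β x) mod v) = 0`** when `ψ` has kernel the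
trace hyperplane of `β` (`ψ(a) = 1 ↔ Tr_{F/𝔽_p}(β a) = 0`): transitivity of the trace in
`𝔽_p ⊆ F ⊆ F_v` and `F`-linearity of `Tr_{F_v/F}`. Here `x` is any element integral at `v ≠ ∞`.
[cite: KohelShparlinski2000, §2 (ψ(z) = e_p(Tr(αz)))] -/
theorem apply_nsmul_traceResidue_eq_one_iff (p : ℕ) [Fact p.Prime] [CharP F p] [Fintype F]
    [Algebra (ZMod p) F] {ψ : AddChar F ℂ} {β : F}
    (hker : ∀ a : F, ψ a = 1 ↔ Algebra.trace (ZMod p) F (β * a) = 0)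
    {v : PlaceOver F V.FunctionField} (hv : v ≠ infPlace V) {x : V.FunctionField}
    (hx : x ∈ v.toValuationSubring) [Algebra (ZMod p) v.residueField] (m : ℕ) :
    ψ (m • PlaceOver.traceResidue (infPlace V) x v) = 1 ↔
      (m : ZMod p) * Algebra.trace (ZMod p) v.residueField
        (IsLocalRing.residue v.toValuationSubring
          ⟨algebraMap F V.FunctionField β * x, mul_mem (v.algebraMap_mem β) hx⟩) = 0 := by
  haveI : Finite v.residueField := PlaceOver.finite_residueField v
  haveI : FiniteDimensional F v.residueField := PlaceOver.finiteDimensional_residueField_holds v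
  haveI : FiniteDimensional (ZMod p) F := Module.Finite.of_finite
  haveI : IsScalarTower (ZMod p) F v.residueField :=
    IsScalarTower.of_algebraMap_eq fun c => by
      have hsub : (algebraMap (ZMod p) v.residueField) =
          (algebraMap F v.residueField).comp (algebraMap (ZMod p) F) := Subsingleton.elim _ _
      exact congrFun (congrArg DFunLike.coe hsub) c
  rw [hker, PlaceOver.traceResidue_of_mem hv hx]
  -- `β * (m • Tr(x̄)) = Tr(m • (β̄ x̄))`
  set xb : v.residueField := IsLocalRing.residue v.toValuationSubring ⟨x, hx⟩ with hxb
  have hres : IsLocalRing.residue v.toValuationSubring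
      ⟨algebraMap F V.FunctionField β * x, mul_mem (v.algebraMap_mem β) hx⟩ =
        algebraMap F v.residueField β * xb := by
    rw [PlaceOver.algebraMap_residueField_apply, ← map_mul]
    rfl
  have h1 : β * (m • Algebra.trace F v.residueField xb) =
      Algebra.trace F v.residueField (m • (algebraMap F v.residueField β * xb)) := by
    rw [map_nsmul, ← Algebra.smul_def, LinearMap.map_smul, smul_eq_mul, mul_smul_comm]
  rw [h1, hres, Algebra.trace_trace, map_nsmul, nsmul_eq_mul]

/-- **`m · pt(v) = O ↔ f ∣ m`** when `f` is the order of `pt(v)` in `W(F)`. [folklore] -/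
theorem nsmul_pointOfDivisor_eq_zero_iff {f : ℕ} {v : PlaceOver F V.FunctionField}
    (hf : f = addOrderOf (pointOfDivisor V (Finsupp.single v 1))) (m : ℕ) :
    m • pointOfDivisor V (Finsupp.single v 1) = 0 ↔ f ∣ m := by
  rw [hf, addOrderOf_dvd_iff_nsmul_eq_zero]

/-! ### The elementary matching identity -/

omit [V.IsElliptic] in
/-- **The per-place matching of the character sum with the place count of the covering.** For natural
numbers `n p d f r` with `d ∣ r`, `0 < d`, `p` prime, `m = r / d`, and `c ∈ 𝔽_p`:
`d · (n[f ∣ m]) · (p[m c = 0]) = (if f c = 0 then n p d [f d ∣ r] else n p d [p f d ∣ r])`.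
(If `c = 0` both are `n p d [f ∣ m]`; if `c ≠ 0` and `p ∣ f` both are `n p d [f ∣ m]` as `p ∣ f ∣ m`;
if `c ≠ 0` and `p ∤ f` both are `n p d [p f ∣ m]` as `gcd(p, f) = 1`.) [folklore] -/
theorem orbitCount_arith {p : ℕ} [Fact p.Prime] {n d f r : ℕ} (hd : 0 < d) (hdr : d ∣ r) (c : ZMod p) :
    (d : ℂ) * ((if f ∣ r / d then (n : ℂ) else 0) * (if ((r / d : ℕ) : ZMod p) * c = 0 then (p : ℂ) else 0)) =
      ((if (f : ZMod p) * c = 0 then (if f * d ∣ r then n * p * d else 0)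
        else (if p * (f * d) ∣ r then n * p * d else 0) : ℕ) : ℂ) := by
  have hp : p.Prime := Fact.out
  obtain ⟨m, rfl⟩ := hdr
  have hm : d * m / d = m := Nat.mul_div_cancel_left m hd
  rw [hm]
  have hfd : f * d ∣ d * m ↔ f ∣ m := by
    rw [mul_comm f d]; exact Nat.mul_dvd_mul_iff_left hd
  have hpfd : p * (f * d) ∣ d * m ↔ p * f ∣ m := by
    rw [show p * (f * d) = d * (p * f) by ring]; exact Nat.mul_dvd_mul_iff_left hd
  have hmp : ((m : ℕ) : ZMod p) = 0 ↔ p ∣ m := ZMod.natCast_eq_zero_iff m p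
  have hfp : ((f : ℕ) : ZMod p) = 0 ↔ p ∣ f := ZMod.natCast_eq_zero_iff f p
  by_cases hc : c = 0
  · subst hc
    simp only [mul_zero, ↓reduceIte, hfd]
    split_ifs <;> push_cast <;> ring
  · have hmc : ((m : ℕ) : ZMod p) * c = 0 ↔ p ∣ m := by rw [mul_eq_zero, or_iff_left hc, hmp]
    have hfc : ((f : ℕ) : ZMod p) * c = 0 ↔ p ∣ f := by rw [mul_eq_zero, or_iff_left hc, hfp]
    simp only [hmc, hfc, hfd, hpfd]
    by_cases hpf : p ∣ f
    · -- `p ∣ f`: `[f ∣ m] · [p ∣ m] = [f ∣ m]`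
      simp only [hpf, ↓reduceIte]
      by_cases hfm : f ∣ m
      · rw [if_pos hfm, if_pos (dvd_trans hpf hfm), if_pos hfm]; push_cast; ring
      · rw [if_neg hfm, if_neg hfm]; simp
    · -- `p ∤ f`: `[f ∣ m] · [p ∣ m] = [p f ∣ m]`
      simp only [hpf, ↓reduceIte]
      have hcop : Nat.Coprime p f := (Nat.Prime.coprime_iff_not_dvd hp).2 hpf
      by_cases hfm : f ∣ m
      · by_cases hpm : p ∣ m
        · rw [if_pos hfm, if_pos hpm, if_pos (Nat.Coprime.mul_dvd_of_dvd_of_dvd hcop hpm hfm)]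
          push_cast; ring
        · rw [if_pos hfm, if_neg hpm, if_neg (fun h => hpm (dvd_trans (Dvd.intro _ rfl) h))]; simp
      · rw [if_neg hfm, if_neg (fun h => hfm (dvd_trans (Dvd.intro_left _ rfl) h))]; simp

end Literature.NumberTheory.EllipticCurves.KohelShparlinski
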